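import Mathlib
import Summits.ResolutionOfSingularities.ResolutionOfSingularities.Theorems.WildQuotientsWildQuotientResolutionLinearCyclicFourfoldOfFinals
import Summits.ResolutionOfSingularities.ResolutionOfSingularities.Theorems.WildQuotientsWildQuotientResolutionLinearSqZero

/-!
# The linear sector of `CyclicQuotientFourfolds` in EVERY characteristic, modulo the two finals

(crux stmt-ResolutionOfSingularities-15640 `WildQuotients.WildQuotientResolution`, line `Sketch`,
sector `|G| = p`; programme of `L/w45c/CHAIN.md` v7.8, RULING 09:06Z (c) «stub-3 = the
`linearCyclicQuotientFourfold_hasResolution` ALL-p skeleton against F1/V4U-F names».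
[OURS · L1 W4.5c] — NOT a statement of any manuscript; replaces the role of no printed item.)

`LinearPowFour.linearCyclicQuotientFourfold_hasResolution_of_finals_all`: for EVERY prime `p`, every
field `k` of characteristic `p`, `n ≤ 4` and every LINEAR `σ ∈ Aut_k k[x₁,…,xₙ]` with `σ^p = 1` on
the coordinates, `Spec k[x]^⟨σ⟩` has a resolution of singularities, PROVIDED the two finals hold in
the characteristics where they are needed: the `J₃` final for `p ≥ 3` (V3U-F1
`ToricExit.jordanThree_hasResolution`, res-L1-w45c-lead-1) and the `J₄` final for `p ≥ 5` (V4U-F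
`JordanFour.jordanFour_hasResolution`). Cases: `p = 2` — `σ` is an involution, SQZ-4
`LinearSqZero.linearInvolution_hasResolution_charTwo` (p478142); `p = 3` — `(σ − 1)³ = σ³ − 1 = 0`,
`LinearCubeZero.linearCyclicQuotient_hasResolution_of_cube_zero_of_jordanThree` (stub-4, p484872)
with the `J₃` final; `p ≥ 5` — `linearCyclicQuotientFourfold_hasResolution_of_finals'` (p490375).
The unconditional theorem is this one applied to the two finals once both have landed.
-/

-- single-problem summit: the doubled namespace component `ResolutionOfSingularities` is forced
set_option linter.dupNamespace false

noncomputable section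

open Module MvPolynomial AlgebraicGeometry
open Literature.AlgebraicGeometry.Resolution

namespace Summit.ResolutionOfSingularities.ResolutionOfSingularities.Theorems.WildQuotientResolution.LinearPowFour

/-- In characteristic `3`, a linear `σ` with `σ³ = 1` on the coordinates satisfies `(σ − 1)³ = 0`
on the coordinates (`(σ − 1)³ = σ³ − 3σ² + 3σ − 1 = σ³ − 1`). [folklore] -/
theorem cube_zero_of_pow_three (k : Type) [Field k] [CharP k 3] (n : ℕ)
    (σ : MvPolynomial (Fin n) k ≃ₐ[k] MvPolynomial (Fin n) k)
    (hσp : ∀ i, (σ ^ 3) (X i) = X i) (i : Fin n) :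
    σ (σ (σ (X i) - X i) - (σ (X i) - X i)) = σ (σ (X i) - X i) - (σ (X i) - X i) := by
  have h3 : (3 : MvPolynomial (Fin n) k) = 0 := by
    have h := CharP.cast_eq_zero (MvPolynomial (Fin n) k) 3
    exact_mod_cast h
  have hs3 : σ (σ (σ (X i))) = X i := by
    have h := hσp i
    rwa [pow_succ, pow_two, AlgEquiv.mul_apply, AlgEquiv.mul_apply] at h
  simp only [map_sub]
  linear_combination (-(σ (σ (X i)) - σ (X i))) * h3 + hs3

/-- **The linear sector of `CyclicQuotientFourfolds` in every characteristic, modulo the finals.**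
For every prime `p`, `n ≤ 4` and every linear `σ` of order dividing `p` on `𝔸ⁿ_k` (`char k = p`),
`𝔸ⁿ/⟨σ⟩` has a resolution of singularities, given the `J₃` final when `p ≥ 3` and the `J₄` final
when `p ≥ 5`. [OURS · L1 W4.5c] [folklore; assembly of landed decls] -/
theorem linearCyclicQuotientFourfold_hasResolution_of_finals_all (p : ℕ) (hp : p.Prime)
    (k : Type) [Field k] [CharP k p]
    (hJ3 : 3 ≤ p → ∀ (n : ℕ) (σ : MvPolynomial (Fin n) k ≃ₐ[k] MvPolynomial (Fin n) k)
      (a b c : Fin n), a ≠ b → b ≠ c → a ≠ c → σ (X b) = X b + X a → σ (X c) = X c + X b →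
      (∀ i, i ≠ b → i ≠ c → σ (X i) = X i) →
      Scheme.HasResolution
        (Spec (.of (FixedPoints.subalgebra k (MvPolynomial (Fin n) k) (Subgroup.zpowers σ)))))
    (hJ4 : 5 ≤ p → ∀ (n : ℕ) (σ : MvPolynomial (Fin n) k ≃ₐ[k] MvPolynomial (Fin n) k)
      (a b c d : Fin n), a ≠ b → a ≠ c → a ≠ d → b ≠ c → b ≠ d → c ≠ d →
      σ (X b) = X b + X a → σ (X c) = X c + X b → σ (X d) = X d + X c →
      (∀ i, i ≠ b → i ≠ c → i ≠ d → σ (X i) = X i) →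
      Scheme.HasResolution
        (Spec (.of (FixedPoints.subalgebra k (MvPolynomial (Fin n) k) (Subgroup.zpowers σ)))))
    (n : ℕ) (hn : n ≤ 4) (σ : MvPolynomial (Fin n) k ≃ₐ[k] MvPolynomial (Fin n) k)
    (hlin : ∀ i, σ (X i) ∈ Submodule.span k (Set.range (X : Fin n → MvPolynomial (Fin n) k)))
    (hσp : ∀ i, (σ ^ p) (X i) = X i) :
    Scheme.HasResolution
      (Spec (.of (FixedPoints.subalgebra k (MvPolynomial (Fin n) k) (Subgroup.zpowers σ)))) := by
  rcases Nat.lt_or_ge p 5 with hlt | hge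
  · have h2 := hp.two_le
    interval_cases p
    · -- `p = 2`: an involution
      refine LinearSqZero.linearInvolution_hasResolution_charTwo k n σ hlin fun i => ?_
      have h := hσp i
      rwa [pow_two, AlgEquiv.mul_apply] at h
    · -- `p = 3`: `(σ − 1)³ = 0`
      exact LinearCubeZero.linearCyclicQuotient_hasResolution_of_cube_zero_of_jordanThree 3 hp k
        (hJ3 le_rfl) n hn σ hlin (cube_zero_of_pow_three k n σ hσp)
    · exact absurd hp (by norm_num)
  · exact linearCyclicQuotientFourfold_hasResolution_of_finals' p hp k (hJ3 (by omega)) (hJ4 hge) n hn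
      σ hlin hσp

end Summit.ResolutionOfSingularities.ResolutionOfSingularities.Theorems.WildQuotientResolution.LinearPowFour

end
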